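/-
Copyright (c) 2026. All rights reserved.
Released under Apache 2.0 license as described in the file LICENSE.
-/
import Mathlib
import Summits.RiemannHypothesis.RiemannHypothesis.Theorems.HandoffLatticeTailDepth
import HarnessLib

/-!
# THEOREM P for data with ONE INTERIOR JUMP (the slaved completions' class)

`HANDOFF/prove-1` gen15, ATTEMPT-22 §3 (S22-c). The slaved completion `f* = f_out + k*` of a window
datum (idea-1 §131.1, L-EL) is real-analytic on the inner zone and smooth on the window but in
general JUMPS at `x = 1/λ`. Müntz's formula — hence THEOREM P, and the hypotheses `hB`/`hMuntz` of
the ζ-side identities and of THEOREMS F1/F2 (`HandoffLatticeTailZetaSide`, `…Floor`, `…FloorWeighted`)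
— is supplied here for such data: `F = G₁` on `(0, a]`, `F = G₂` on `(a, λ]`, `F = 0` beyond `λ`,
`G₁` Lipschitz on `[0, a]`, `G₂` Lipschitz on `[0, λ]` (the outer piece extended inward by any
Lipschitz formula, e.g. its polynomial), `∫_0^a G₁ + ∫_a^λ G₂ = 0`.

Trick: `F = 1_{(0,a]}·(G₁ − G₂ + c(a − x)) + 1_{(0,λ]}·(G₂ − c·max(a − x, 0))`, `c = 2(∫_0^λ G₂)/a²`;
both pieces are in the tree's Müntz class (Lipschitz on `[0, A]`, zero integral); Müntz is linear.
RH-free; nothing here bears on the truth of RH.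
-/

noncomputable section

set_option linter.dupNamespace false

open Complex MeasureTheory Set Filter
open Literature.NumberTheory.LFunctions
open scoped NNReal

namespace Summit.RiemannHypothesis.RiemannHypothesis.Theorems

namespace LatticeUncertainty

variable {lam : ℝ} {F : ℝ → ℂ}

/-- A function continuous on `[a, b]` and nonzero at some `x₀ ∈ (a, b]` is not a.e. zero on
`(a, b]`. -/
theorem not_ae_eq_zero_of_continuousOn_Icc {G : ℝ → ℂ} {a b x₀ : ℝ}
    (hcont : ContinuousOn G (Icc a b)) (hx₀ : x₀ ∈ Ioc a b) (hG : G x₀ ≠ 0) :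
    ¬ ∀ᵐ x ∂(volume.restrict (Ioc a b)), G x = 0 := by
  intro h
  have hx₀' : x₀ ∈ Icc a b := ⟨hx₀.1.le, hx₀.2⟩
  obtain ⟨η, hη, hηG⟩ := (Metric.continuousWithinAt_iff.mp (hcont x₀ hx₀')) ‖G x₀‖
    (norm_pos_iff.mpr hG)
  set a' := max ((a + x₀) / 2) (x₀ - η / 2) with ha'
  have hax : a' < x₀ := max_lt (by linarith [hx₀.1]) (by linarith)
  have ha0 : a < a' := lt_max_of_lt_left (by linarith [hx₀.1])
  have hS : Ioo a' x₀ ⊆ {x | ¬ (x ∈ Ioc a b → G x = 0)} := by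
    intro x hx hx'
    have hxI : x ∈ Icc a b := ⟨(ha0.trans hx.1).le, hx.2.le.trans hx₀.2⟩
    have hdist : dist x x₀ < η := by
      rw [Real.dist_eq, abs_sub_lt_iff]
      constructor <;> linarith [hx.1, hx.2, le_max_right ((a + x₀) / 2) (x₀ - η / 2)]
    have := hηG hxI hdist
    rw [hx' ⟨ha0.trans hx.1, hx.2.le.trans hx₀.2⟩, dist_zero_left] at this
    exact lt_irrefl _ this
  have hnull : volume {x | ¬ (x ∈ Ioc a b → G x = 0)} = 0 :=
    ae_iff.mp ((ae_restrict_iff' measurableSet_Ioc).mp h)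
  have := measure_mono_null hS hnull
  rw [Real.volume_Ioo, ENNReal.ofReal_eq_zero] at this
  linarith

/-- Absolute convergence of the Mellin transform on `Re s > 0` of `1_{(0,A]}·f` for `f` continuous
on `[0, A]` (dominated by `M·t^{Re s - 1}`). -/
theorem mellinConvergent_indicator_of_continuousOn {f : ℝ → ℂ} {A : ℝ} (hA : 0 < A)
    (hf : ContinuousOn f (Icc 0 A)) {s : ℂ} (hs : 0 < s.re) :
    MellinConvergent ((Ioc 0 A).indicator f) s := by
  obtain ⟨M, hM⟩ : ∃ M, ∀ t ∈ Icc 0 A, ‖f t‖ ≤ M := isCompact_Icc.exists_bound_of_continuousOn hf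
  have hM0 : 0 ≤ M := (norm_nonneg _).trans (hM 0 ⟨le_rfl, hA.le⟩)
  -- the integrand equals `1_{(0,A]}·(t^{s-1} f t)`
  have heq : (fun t : ℝ ↦ (t : ℂ) ^ (s - 1) • (Ioc 0 A).indicator f t) =
      (Ioc 0 A).indicator (fun t : ℝ ↦ (t : ℂ) ^ (s - 1) • f t) := by
    funext t
    by_cases ht : t ∈ Ioc 0 A
    · rw [indicator_of_mem ht, indicator_of_mem ht]
    · rw [indicator_of_notMem ht, indicator_of_notMem ht, smul_zero]
  rw [MellinConvergent, heq]
  refine (IntegrableOn.integrable_indicator ?_ measurableSet_Ioc).integrableOn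
  -- integrability on `(0, A]` by domination
  have hg : IntegrableOn (fun t : ℝ ↦ M * t ^ (s.re - 1)) (Ioc 0 A) :=
    ((intervalIntegral.intervalIntegrable_rpow' (a := 0) (b := A) (by linarith)).1).const_mul _
  have hc : ContinuousOn (fun t : ℝ ↦ (t : ℂ) ^ (s - 1)) (Ioi 0) := fun t ht ↦
    (continuousAt_ofReal_cpow_const _ _ (Or.inr (ne_of_gt ht))).continuousWithinAt
  refine Integrable.mono' hg ?_ ?_
  · exact ((hc.mono Ioc_subset_Ioi_self).aestronglyMeasurable measurableSet_Ioc).smul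
      ((hf.mono Ioc_subset_Icc_self).aestronglyMeasurable measurableSet_Ioc)
  · refine (ae_restrict_iff' measurableSet_Ioc).mpr (Eventually.of_forall fun t ht ↦ ?_)
    rw [norm_smul, Complex.norm_cpow_eq_rpow_re_of_pos ht.1, sub_re, one_re, mul_comm]
    exact mul_le_mul_of_nonneg_right (hM t ⟨ht.1.le, ht.2⟩) (Real.rpow_nonneg ht.1.le _)

/-- `∫_0^a (a - x) dx = a²/2`. -/
theorem intervalIntegral_const_sub_self (a : ℝ) : ∫ x in (0 : ℝ)..a, (a - x) = a ^ 2 / 2 := by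
  have h := intervalIntegral.integral_comp_sub_left (fun x : ℝ ↦ x) a (a := 0) (b := a)
  simp only [sub_self, sub_zero] at h
  rw [h, integral_id]
  ring

section Jump

variable {a : ℝ} {G₁ G₂ : ℝ → ℂ} {L₁ L₂ : ℝ≥0}
variable (ha : 0 < a) (hal : a < lam) (hG₁ : LipschitzOnWith L₁ G₁ (Icc 0 a))
  (hG₂ : LipschitzOnWith L₂ G₂ (Icc 0 lam)) (hF₁ : ∀ x ∈ Ioc 0 a, F x = G₁ x)
  (hF₂ : ∀ x ∈ Ioc a lam, F x = G₂ x) (hFs : ∀ x, lam < x → F x = 0)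
  (hint : (∫ t in (0 : ℝ)..a, G₁ t) + ∫ t in a..lam, G₂ t = 0)
include ha hal hG₁ hG₂ hF₁ hF₂ hFs hint

/-! The two pieces, for a correction slope `c : ℂ` (the zero-integral conditions pin
`c = 2(∫_0^λ G₂)/a²`, written multiplicatively as `hc : c·a² = 2∫_0^λ G₂`):
piece 1 `x ↦ G₁ x − G₂ x + c(a − x)` on `(0, a]`, piece 2 `x ↦ G₂ x − c·max(a − x, 0)` on `(0, λ]`. -/

variable (c : ℂ)

omit ha hG₁ hG₂ hint in
/-- The decomposition `F = 1_{(0,a]}·(G₁ − G₂ + c(a−x)) + 1_{(0,λ]}·(G₂ − c·max(a−x,0))` on `(0, ∞)`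
(for every `c`). -/
theorem jump_decomposition {x : ℝ} (hx : 0 < x) :
    F x = (Ioc 0 a).indicator (fun x : ℝ ↦ G₁ x - G₂ x + c * ((a - x : ℝ) : ℂ)) x + (Ioc 0 lam).indicator (fun x : ℝ ↦ G₂ x - c * ((max (a - x) 0 : ℝ) : ℂ)) x := by
  by_cases h1 : x ≤ a
  · have hmax : max (a - x) 0 = a - x := max_eq_left (by linarith)
    rw [indicator_of_mem (mem_Ioc.mpr ⟨hx, h1⟩), indicator_of_mem (mem_Ioc.mpr ⟨hx, by linarith⟩),
      hF₁ x ⟨hx, h1⟩, hmax]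
    ring
  by_cases h2 : x ≤ lam
  · have hmax : max (a - x) 0 = 0 := max_eq_right (by linarith)
    rw [indicator_of_notMem (fun h ↦ h1 (mem_Ioc.mp h).2),
      indicator_of_mem (mem_Ioc.mpr ⟨hx, h2⟩), hF₂ x ⟨not_le.mp h1, h2⟩, hmax]
    simp
  · rw [indicator_of_notMem (fun h ↦ h1 (mem_Ioc.mp h).2),
      indicator_of_notMem (fun h ↦ h2 (mem_Ioc.mp h).2), hFs x (not_le.mp h2)]
    simp

omit ha hal hF₁ hF₂ hFs hint in
/-- Piece 1 is Lipschitz on `[0, a]`. -/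
theorem lipschitzOnWith_piece1 (hal' : a ≤ lam) :
    LipschitzOnWith (L₁ + L₂ + ‖c‖₊ * 1) (fun x : ℝ ↦ G₁ x - G₂ x + c * ((a - x : ℝ) : ℂ)) (Icc 0 a) := by
  have hlin : LipschitzWith (‖c‖₊ * 1) (fun x : ℝ ↦ c * ((a - x : ℝ) : ℂ)) := by
    refine LipschitzWith.of_dist_le_mul fun x y ↦ ?_
    rw [dist_eq_norm, ← mul_sub, norm_mul, dist_eq_norm, NNReal.coe_mul, NNReal.coe_one, mul_one,
      coe_nnnorm]
    gcongr
    rw [← Complex.ofReal_sub, Complex.norm_real, Real.norm_eq_abs, Real.norm_eq_abs,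
      show a - x - (a - y) = -(x - y) by ring, abs_neg]
  exact (hG₁.sub (hG₂.mono (Icc_subset_Icc_right hal'))).add hlin.lipschitzOnWith

omit ha hal hG₁ hF₁ hF₂ hFs hint in
/-- Piece 2 is Lipschitz on `[0, λ]`. -/
theorem lipschitzOnWith_piece2 : LipschitzOnWith (L₂ + ‖c‖₊ * 1) (fun x : ℝ ↦ G₂ x - c * ((max (a - x) 0 : ℝ) : ℂ)) (Icc 0 lam) := by
  have hlin : LipschitzWith (‖c‖₊ * 1) (fun x : ℝ ↦ c * ((max (a - x) 0 : ℝ) : ℂ)) := by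
    refine LipschitzWith.of_dist_le_mul fun x y ↦ ?_
    rw [dist_eq_norm, ← mul_sub, norm_mul, dist_eq_norm, NNReal.coe_mul, NNReal.coe_one, mul_one,
      coe_nnnorm]
    gcongr
    rw [← Complex.ofReal_sub, Complex.norm_real, Real.norm_eq_abs, Real.norm_eq_abs]
    have := abs_max_sub_max_le_abs (a - x) (a - y) 0
    calc |max (a - x) 0 - max (a - y) 0| ≤ |a - x - (a - y)| := this
      _ = |x - y| := by rw [show a - x - (a - y) = -(x - y) by ring, abs_neg]
  exact hG₂.sub hlin.lipschitzOnWith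

omit hF₁ hF₂ hFs in
/-- `∫_0^a (fun x : ℝ ↦ G₁ x - G₂ x + c * ((a - x : ℝ) : ℂ)) = 0`. -/
theorem intervalIntegral_piece1 (hc : c * (a : ℂ) ^ 2 = 2 * ∫ t in (0 : ℝ)..lam, G₂ t) :
    ∫ t in (0 : ℝ)..a, (fun x : ℝ ↦ G₁ x - G₂ x + c * ((a - x : ℝ) : ℂ)) t = 0 := by
  have hI1 : IntervalIntegrable G₁ volume 0 a :=
    (hG₁.continuousOn.mono (by rw [uIcc_of_le ha.le])).intervalIntegrable
  have hI2 : IntervalIntegrable G₂ volume 0 a :=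
    (hG₂.continuousOn.mono (by rw [uIcc_of_le ha.le]; exact Icc_subset_Icc_right hal.le)).intervalIntegrable
  have hI2' : IntervalIntegrable G₂ volume a lam :=
    (hG₂.continuousOn.mono (by rw [uIcc_of_le hal.le]; exact Icc_subset_Icc_left ha.le)).intervalIntegrable
  have hI3 : IntervalIntegrable (fun x : ℝ ↦ c * ((a - x : ℝ) : ℂ)) volume 0 a :=
    ((continuous_const.mul (Complex.continuous_ofReal.comp (continuous_const.sub continuous_id))).intervalIntegrable _ _)
  have hlin : ∫ t in (0 : ℝ)..a, c * ((a - t : ℝ) : ℂ) = c * ((a ^ 2 / 2 : ℝ) : ℂ) := by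
    rw [intervalIntegral.integral_const_mul, intervalIntegral.integral_ofReal,
      intervalIntegral_const_sub_self]
  have hsplit : ∫ t in (0 : ℝ)..lam, G₂ t = (∫ t in (0 : ℝ)..a, G₂ t) + ∫ t in a..lam, G₂ t :=
    (intervalIntegral.integral_add_adjacent_intervals hI2 hI2').symm
  have hc' : c * ((a ^ 2 / 2 : ℝ) : ℂ) = ∫ t in (0 : ℝ)..lam, G₂ t := by
    push_cast
    linear_combination hc / 2
  rw [intervalIntegral.integral_add (hI1.sub hI2) hI3, intervalIntegral.integral_sub hI1 hI2, hlin, hc']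
  linear_combination hint + hsplit

omit hG₁ hF₁ hF₂ hFs hint in
/-- `∫_0^λ (fun x : ℝ ↦ G₂ x - c * ((max (a - x) 0 : ℝ) : ℂ)) = 0`. -/
theorem intervalIntegral_piece2 (hc : c * (a : ℂ) ^ 2 = 2 * ∫ t in (0 : ℝ)..lam, G₂ t) :
    ∫ t in (0 : ℝ)..lam, (fun x : ℝ ↦ G₂ x - c * ((max (a - x) 0 : ℝ) : ℂ)) t = 0 := by
  have hlam : 0 < lam := ha.trans hal
  have hI2 : IntervalIntegrable G₂ volume 0 lam :=
    (hG₂.continuousOn.mono (by rw [uIcc_of_le hlam.le])).intervalIntegrable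
  have hcont : Continuous (fun x : ℝ ↦ c * ((max (a - x) 0 : ℝ) : ℂ)) :=
    continuous_const.mul (Complex.continuous_ofReal.comp
      ((continuous_const.sub continuous_id).max continuous_const))
  have hmax : ∫ t in (0 : ℝ)..lam, c * ((max (a - t) 0 : ℝ) : ℂ) = c * ((a ^ 2 / 2 : ℝ) : ℂ) := by
    rw [intervalIntegral.integral_const_mul, intervalIntegral.integral_ofReal]
    congr 2
    have hmc : Continuous (fun t : ℝ ↦ max (a - t) 0) :=
      (continuous_const.sub continuous_id).max continuous_const
    rw [← intervalIntegral.integral_add_adjacent_intervals (hmc.intervalIntegrable 0 a)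
      (hmc.intervalIntegrable a lam)]
    have e1 : ∫ t in (0 : ℝ)..a, max (a - t) 0 = ∫ t in (0 : ℝ)..a, (a - t) :=
      intervalIntegral.integral_congr fun t ht ↦ by
        rw [uIcc_of_le ha.le] at ht; exact max_eq_left (by linarith [ht.2])
    have e2 : ∫ t in a..lam, max (a - t) 0 = ∫ t in a..lam, (0 : ℝ) :=
      intervalIntegral.integral_congr fun t ht ↦ by
        rw [uIcc_of_le hal.le] at ht; exact max_eq_right (by linarith [ht.1])
    rw [e1, e2, intervalIntegral_const_sub_self, intervalIntegral.integral_const, smul_zero, add_zero]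
  have hc' : c * ((a ^ 2 / 2 : ℝ) : ℂ) = ∫ t in (0 : ℝ)..lam, G₂ t := by
    push_cast
    linear_combination hc / 2
  rw [intervalIntegral.integral_sub hI2 (hcont.intervalIntegrable _ _), hmax, hc', sub_self]

omit ha hG₁ hG₂ hint in
/-- The dilation sum splits along the decomposition (on `u > 0`). -/
theorem dilationSum_jump {u : ℝ} (hu : 0 < u) :
    dilationSum lam F u = dilationSum lam ((Ioc 0 a).indicator (fun x : ℝ ↦ G₁ x - G₂ x + c * ((a - x : ℝ) : ℂ))) u +
      dilationSum lam ((Ioc 0 lam).indicator (fun x : ℝ ↦ G₂ x - c * ((max (a - x) 0 : ℝ) : ℂ))) u := by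
  unfold dilationSum
  rw [← Finset.sum_add_distrib]
  refine Finset.sum_congr rfl fun n hn ↦ ?_
  have hn1 : 1 ≤ n := (Finset.mem_Icc.mp hn).1
  exact jump_decomposition hal hF₁ hF₂ hFs c (by positivity)

/-- **Müntz's formula for one-jump data** (the hypothesis `hMuntz` of the ζ-side files). -/
theorem mellin_dilationSum_eq_zeta_mul_of_jump {s : ℂ} (hs : 0 < s.re) (hs1 : s ≠ 1) :
    mellin (dilationSum lam F) s = riemannZeta s * mellin F s := by
  have hlam : 0 < lam := ha.trans hal
  set c : ℂ := 2 * (∫ t in (0 : ℝ)..lam, G₂ t) / (a : ℂ) ^ 2 with hc_def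
  have hc : c * (a : ℂ) ^ 2 = 2 * ∫ t in (0 : ℝ)..lam, G₂ t := by
    have ha1 : (a : ℂ) ≠ 0 := Complex.ofReal_ne_zero.mpr ha.ne'
    rw [hc_def]; field_simp
  have hL1 := lipschitzOnWith_piece1 hG₁ hG₂ c hal.le
  have hL2 := lipschitzOnWith_piece2 (lam := lam) (a := a) hG₂ (L₂ := L₂) c
  have T1 := mellin_tsum_indicator_comp_mul_nat ha hL1
    (intervalIntegral_piece1 ha hal hG₁ hG₂ hint c hc) hs hs1
  have T2 := mellin_tsum_indicator_comp_mul_nat hlam hL2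
    (intervalIntegral_piece2 ha hal hG₂ c hc) hs hs1
  set p₁ := (Ioc 0 a).indicator (fun x : ℝ ↦ G₁ x - G₂ x + c * ((a - x : ℝ) : ℂ)) with hp₁
  set p₂ := (Ioc 0 lam).indicator (fun x : ℝ ↦ G₂ x - c * ((max (a - x) 0 : ℝ) : ℂ)) with hp₂
  have hp₁s : ∀ x, lam < x → p₁ x = 0 := fun x hx ↦
    indicator_of_notMem (fun h ↦ not_lt.mpr (h.2.trans hal.le) hx) _
  have hp₂s : ∀ x, lam < x → p₂ x = 0 := fun x hx ↦
    indicator_of_notMem (fun h ↦ not_lt.mpr h.2 hx) _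
  -- `mellin (θ_F) = mellin (Σ p₁) + mellin (Σ p₂)`
  have hsum : mellin (dilationSum lam F) s =
      mellin (fun x ↦ ∑' n : ℕ, p₁ ((n + 1 : ℕ) * x)) s +
        mellin (fun x ↦ ∑' n : ℕ, p₂ ((n + 1 : ℕ) * x)) s := by
    rw [mellin, mellin, mellin, ← integral_add T1.1 T2.1]
    refine setIntegral_congr_fun measurableSet_Ioi fun u hu ↦ ?_
    rw [← smul_add, dilationSum_jump hal hF₁ hF₂ hFs c hu, dilationSum_eq_tsum_nat hp₁s hu,
      dilationSum_eq_tsum_nat hp₂s hu]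
  -- `mellin F = mellin p₁ + mellin p₂`
  have hF : mellin F s = mellin p₁ s + mellin p₂ s := by
    have c1 := mellinConvergent_indicator_of_continuousOn ha hL1.continuousOn hs
    have c2 := mellinConvergent_indicator_of_continuousOn hlam hL2.continuousOn hs
    rw [mellin, mellin, mellin, ← integral_add c1 c2]
    refine setIntegral_congr_fun measurableSet_Ioi fun u hu ↦ ?_
    rw [← smul_add, jump_decomposition hal hF₁ hF₂ hFs c hu]
  rw [hsum, T1.2, T2.2, hF, mul_add]

/-- **Boundedness of the dilation sum for one-jump data** (the hypothesis `hB`). -/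
theorem norm_dilationSum_le_of_jump : ∃ B : ℝ, ∀ u, ‖dilationSum lam F u‖ ≤ B := by
  have hlam : 0 < lam := ha.trans hal
  set c : ℂ := 2 * (∫ t in (0 : ℝ)..lam, G₂ t) / (a : ℂ) ^ 2 with hc_def
  have hc : c * (a : ℂ) ^ 2 = 2 * ∫ t in (0 : ℝ)..lam, G₂ t := by
    have ha1 : (a : ℂ) ≠ 0 := Complex.ofReal_ne_zero.mpr ha.ne'
    rw [hc_def]; field_simp
  have hL1 := lipschitzOnWith_piece1 hG₁ hG₂ c hal.le
  have hL2 := lipschitzOnWith_piece2 (lam := lam) (a := a) hG₂ (L₂ := L₂) c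
  obtain ⟨M1, hM1⟩ : ∃ M, ∀ t ∈ Icc 0 a, ‖(fun x : ℝ ↦ G₁ x - G₂ x + c * ((a - x : ℝ) : ℂ)) t‖ ≤ M :=
    isCompact_Icc.exists_bound_of_continuousOn hL1.continuousOn
  obtain ⟨M2, hM2⟩ : ∃ M, ∀ t ∈ Icc 0 lam, ‖(fun x : ℝ ↦ G₂ x - c * ((max (a - x) 0 : ℝ) : ℂ)) t‖ ≤ M :=
    isCompact_Icc.exists_bound_of_continuousOn hL2.continuousOn
  set p₁ := (Ioc 0 a).indicator (fun x : ℝ ↦ G₁ x - G₂ x + c * ((a - x : ℝ) : ℂ)) with hp₁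
  set p₂ := (Ioc 0 lam).indicator (fun x : ℝ ↦ G₂ x - c * ((max (a - x) 0 : ℝ) : ℂ)) with hp₂
  have hp₁s : ∀ x, lam < x → p₁ x = 0 := fun x hx ↦
    indicator_of_notMem (fun h ↦ not_lt.mpr (h.2.trans hal.le) hx) _
  have hp₂s : ∀ x, lam < x → p₂ x = 0 := fun x hx ↦
    indicator_of_notMem (fun h ↦ not_lt.mpr h.2 hx) _
  have h01 : 0 ≤ M1 := (norm_nonneg _).trans (hM1 0 ⟨le_rfl, ha.le⟩)
  have h02 : 0 ≤ M2 := (norm_nonneg _).trans (hM2 0 ⟨le_rfl, hlam.le⟩)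
  refine ⟨((L₁ + L₂ + ‖c‖₊ * 1 : ℝ≥0) : ℝ) * a + M1 +
    (((L₂ + ‖c‖₊ * 1 : ℝ≥0) : ℝ) * lam + M2), fun u ↦ ?_⟩
  rcases le_or_gt u 0 with hu | hu
  · have : ⌊lam / u⌋₊ = 0 := Nat.floor_eq_zero.mpr (by
      have := div_nonpos_of_nonneg_of_nonpos hlam.le hu; linarith)
    rw [dilationSum, this, Finset.Icc_eq_empty (by norm_num), Finset.sum_empty, norm_zero]
    exact add_nonneg (add_nonneg (by positivity) h01) (add_nonneg (by positivity) h02)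
  rw [dilationSum_jump hal hF₁ hF₂ hFs c hu, dilationSum_eq_tsum_nat hp₁s hu,
    dilationSum_eq_tsum_nat hp₂s hu]
  have b1 := norm_tsum_indicator_comp_mul_nat_le ha hL1 hM1
    (intervalIntegral_piece1 ha hal hG₁ hG₂ hint c hc) hu
  have b2 := norm_tsum_indicator_comp_mul_nat_le hlam hL2 hM2
    (intervalIntegral_piece2 ha hal hG₂ c hc) hu
  exact (norm_add_le _ _).trans (add_le_add b1 b2)

/-- **THEOREM P for one-jump data.** If `F` is measurable, `= G₁` on `(0,a]`, `= G₂` on `(a,λ]`,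
`0` beyond `λ`, with `∫_0^a G₁ + ∫_a^λ G₂ = 0` and `F x₀ ≠ 0` for some `x₀ ∈ (0, λ]`, then for every
`δ > 0` the dilation sum `θ_F` is not a.e. zero on `(0, δ)`. -/
theorem dilationSum_not_ae_zero_of_jump (hFm : Measurable F) {x₀ : ℝ} (hx₀ : x₀ ∈ Ioc 0 lam)
    (hx : F x₀ ≠ 0) {δ : ℝ} (hδ : 0 < δ) :
    ¬ ∀ᵐ u ∂(volume.restrict (Ioo 0 δ)), dilationSum lam F u = 0 := by
  have hlam : 0 < lam := ha.trans hal
  set F₁ : ℝ → ℂ := (Ioc 0 lam).indicator F with hF₁def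
  obtain ⟨B, hB⟩ := norm_dilationSum_le_of_jump ha hal hG₁ hG₂ hF₁ hF₂ hFs hint
  -- a bound for `F` on `(0, λ]` from the two continuous pieces
  obtain ⟨M1, hM1⟩ : ∃ M, ∀ t ∈ Icc 0 a, ‖G₁ t‖ ≤ M :=
    isCompact_Icc.exists_bound_of_continuousOn hG₁.continuousOn
  obtain ⟨M2, hM2⟩ : ∃ M, ∀ t ∈ Icc 0 lam, ‖G₂ t‖ ≤ M :=
    isCompact_Icc.exists_bound_of_continuousOn hG₂.continuousOn
  have h01 : 0 ≤ M1 := (norm_nonneg _).trans (hM1 0 ⟨le_rfl, ha.le⟩)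
  have h02 : 0 ≤ M2 := (norm_nonneg _).trans (hM2 0 ⟨le_rfl, hlam.le⟩)
  have hF₁m : Measurable F₁ := hFm.indicator measurableSet_Ioc
  have hF₁b : ∀ x, ‖F₁ x‖ ≤ M1 + M2 := by
    intro x
    by_cases hxI : x ∈ Ioc 0 lam
    · rw [hF₁def, indicator_of_mem hxI]
      by_cases h1 : x ≤ a
      · rw [hF₁ x ⟨hxI.1, h1⟩]; linarith [hM1 x ⟨hxI.1.le, h1⟩]
      · rw [hF₂ x ⟨not_le.mp h1, hxI.2⟩]; linarith [hM2 x ⟨hxI.1.le, hxI.2⟩]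
    · rw [hF₁def, indicator_of_notMem hxI, norm_zero]; positivity
  have hF₁s : ∀ x, x ∉ Ioc 0 lam → F₁ x = 0 := fun x hx ↦ indicator_of_notMem hx _
  have hF₁s' : ∀ x, lam < x → F₁ x = 0 := fun x hx ↦ hF₁s x fun h ↦ not_lt.mpr h.2 hx
  have hdil : ∀ u, 0 < u → dilationSum lam F₁ u = dilationSum lam F u := by
    intro u hu
    rw [dilationSum_eq_tsum_nat hF₁s' hu, dilationSum_eq_tsum_indicator hFs hu]
  have hMuntz : ∀ s : ℂ, 0 < s.re → s.re < 1 →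
      mellin (dilationSum lam F₁) s = riemannZeta s * mellin F₁ s := by
    intro s hs hs1
    have hs1' : s ≠ 1 := fun h ↦ by rw [h, one_re] at hs1; exact lt_irrefl _ hs1
    have hmF : mellin F₁ s = mellin F s := by rw [hF₁def]; exact mellin_indicator_Ioc_eq hFs s
    rw [hmF, ← mellin_dilationSum_eq_zeta_mul_of_jump ha hal hG₁ hG₂ hF₁ hF₂ hFs hint hs hs1']
    unfold mellin
    refine setIntegral_congr_fun measurableSet_Ioi fun x hx ↦ ?_
    rw [hdil x hx]
  -- `F₁` is not a.e. zero on `(0, λ]`: `x₀` lies in one of the two pieces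
  have hne : ¬ ∀ᵐ x ∂(volume.restrict (Ioc 0 lam)), F₁ x = 0 := by
    intro h
    have h' : ∀ᵐ x ∂volume, x ∈ Ioc 0 lam → F x = 0 := by
      filter_upwards [(ae_restrict_iff' measurableSet_Ioc).mp h] with x hx hxI
      rw [← hx hxI, hF₁def, indicator_of_mem hxI]
    by_cases h1 : x₀ ≤ a
    · apply not_ae_eq_zero_of_continuousOn_Icc hG₁.continuousOn ⟨hx₀.1, h1⟩
        (by rwa [← hF₁ x₀ ⟨hx₀.1, h1⟩])
      rw [ae_restrict_iff' measurableSet_Ioc]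
      filter_upwards [h'] with x hx hxI
      rw [← hF₁ x hxI]
      exact hx ⟨hxI.1, hxI.2.trans hal.le⟩
    · apply not_ae_eq_zero_of_continuousOn_Icc (hG₂.continuousOn.mono (Icc_subset_Icc_left ha.le))
        ⟨not_le.mp h1, hx₀.2⟩ (by rwa [← hF₂ x₀ ⟨not_le.mp h1, hx₀.2⟩])
      rw [ae_restrict_iff' measurableSet_Ioc]
      filter_upwards [h'] with x hx hxI
      rw [← hF₂ x hxI]
      exact hx ⟨ha.trans hxI.1, hxI.2⟩
  have key := dilationSum_not_ae_zero hlam hF₁m hF₁b hF₁s hMuntz hne hδ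
  intro h
  apply key
  rw [ae_restrict_iff' measurableSet_Ioo] at h ⊢
  filter_upwards [h] with u hu huI
  rw [hdil u huI.1, hu huI]

/-- **THEOREM P for one-jump data, integral form**, and `latticeTail_pos_of_jump`. -/
theorem setIntegral_normSq_dilationSum_pos_of_jump (hFm : Measurable F) {x₀ : ℝ}
    (hx₀ : x₀ ∈ Ioc 0 lam) (hx : F x₀ ≠ 0) {δ : ℝ} (hδ : 0 < δ) :
    0 < ∫ u in Ioc 0 δ, ‖dilationSum lam F u‖ ^ 2 := by
  obtain ⟨B, hB⟩ := norm_dilationSum_le_of_jump ha hal hG₁ hG₂ hF₁ hF₂ hFs hint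
  have hGm : Measurable (fun u ↦ ‖dilationSum lam F u‖ ^ 2) :=
    ((measurable_dilationSum hFm lam).norm).pow_const 2
  have hGi : IntegrableOn (fun u ↦ ‖dilationSum lam F u‖ ^ 2) (Ioc 0 δ) :=
    Measure.integrableOn_of_bounded (M := B ^ 2) (by simp) hGm.aestronglyMeasurable
      (Eventually.of_forall fun u ↦ by
        rw [Real.norm_of_nonneg (by positivity)]
        exact pow_le_pow_left₀ (norm_nonneg _) (hB u) 2)
  by_contra hle
  have h0 : ∫ u in Ioc 0 δ, ‖dilationSum lam F u‖ ^ 2 = 0 :=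
    le_antisymm (not_lt.mp hle) (integral_nonneg fun u ↦ by positivity)
  have hae := (setIntegral_eq_zero_iff_of_nonneg_ae (Eventually.of_forall fun u ↦ by positivity)
    hGi).mp h0
  apply dilationSum_not_ae_zero_of_jump ha hal hG₁ hG₂ hF₁ hF₂ hFs hint hFm hx₀ hx hδ
  have hae' : ∀ᵐ u ∂(volume.restrict (Ioo 0 δ)), ‖dilationSum lam F u‖ ^ 2 = 0 :=
    ae_restrict_of_ae_restrict_of_subset Ioo_subset_Ioc_self hae
  filter_upwards [hae'] with u hu
  simpa using hu

/-- **THEOREM P for the lattice tail of one-jump data**: `0 < latticeTail λ F` (`λ ≥ 1`). -/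
theorem latticeTail_pos_of_jump (hlam1 : 1 ≤ lam) (hFm : Measurable F) {x₀ : ℝ}
    (hx₀ : x₀ ∈ Ioc 0 lam) (hx : F x₀ ≠ 0) : 0 < latticeTail lam F :=
  setIntegral_normSq_dilationSum_pos_of_jump ha hal hG₁ hG₂ hF₁ hF₂ hFs hint hFm hx₀ hx
    (by positivity)

end Jump

end LatticeUncertainty

end Summit.RiemannHypothesis.RiemannHypothesis.Theorems
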